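import Summits.NavierStokesRegularity.NavierStokesRegularity.Theorems.EfficiencyFloorRigidExitResonanceOrbit
import HarnessLib

/-!
# Route `EfficiencyFloor`, crux `MaximiserSetRigidity` (stmt-25512) / support `RigidExit` (stmt-25513) on the
# `ProductionEfficiencyDecay` ladder (stmt-22866): ORBIT COVARIANCE OF THE LU–DOERING FUNCTIONALS

Helper file (`--supports stmt-NavierStokesRegularity-22866`; line `efficiency_floor`). The symmetry group of clause (a)
of `MaximiserSetRigidity` acts on fields by `m ↦ (x ↦ l • R (m (l • R⁻¹ (x − a))))` (`a` a translation, `R` a linear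
isometry of `ℝ³`, `l > 0` the Navier–Stokes scaling). This file proves, with no differentiability hypotheses where
none are needed, the pointwise covariance laws

* `fderiv_orbitSlice`: `D(g·m)(x) = l² · R ∘ Dm(y) ∘ R⁻¹`, `y = l • R⁻¹(x − a)`;
* `curl_orbitSlice`: `curl (g·m)(x) = (l² det R) • R (curl m)(y)` (the vorticity is a pseudovector);
* `fderiv_curl_orbitSlice`: `D curl (g·m)(x) = (l³ det R) · R ∘ D(curl m)(y) ∘ R⁻¹`;

and the integrated laws for the three Lu–Doering functionals

* enstrophy `Z ↦ l·Z` (landed: `RigidExit.integral_curl_sq_orbitSlice`), palinstrophy `Pal ↦ l³·Pal`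
  (`integral_palinstrophy_orbitSlice`), stretching `S ↦ l³·S` (`integral_stretching_orbitSlice`),

hence the efficiency `S/(Z^{3/4} Pal^{3/4})` and the normalisation ratio `Pal/Z³` are orbit invariants and the
NORMALISED-MAXIMISER IDENTITIES of clause (a) (`S = c Z^{3/4} Pal^{3/4}`, `Pal = (81c⁴/(256ν⁴)) Z³`, `0 < Z`) transfer
along every orbit (`normalisedMaximiser_identities_orbitSlice`). This is the consistency fact behind the formulation of
clause (a) ("modulo the symmetry group") and the [M] residue named by the g22 census of stmt-22866.

HONEST FRAMING: identities of vector calculus; clause (a), `RigidExit`, `NearMaximiserBoundedAmplification`,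
`LerayFloorGap`, `ProductionEfficiencyDecay` (stmt-22866) and Navier–Stokes regularity stay OPEN; no summit statement
is proved. [folklore]
-/

-- the problem directory repeats the summit name (`NavierStokesRegularity/NavierStokesRegularity`)
set_option linter.dupNamespace false

noncomputable section

open Set Filter MeasureTheory Topology Function Module
open scoped InnerProductSpace RealInnerProductSpace ENNReal NNReal
open Literature.Analysis Literature.Analysis.FluidPDE

namespace Summit.NavierStokesRegularity.NavierStokesRegularity.Theorems

namespace MaximiserSetRigidity

namespace OrbitInvariance

open RigidExit.Resonance

/-! ## Pointwise covariance under the orbit map -/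

/-- **Jacobian of an orbit slice**: `D(x ↦ l•R(m(l•R⁻¹(x − a))))(x) = l² · R ∘ Dm(l•R⁻¹(x − a)) ∘ R⁻¹`
(no differentiability hypothesis: both sides are junk together). [folklore] -/
theorem fderiv_orbitSlice (m : EuclideanSpace ℝ (Fin 3) → EuclideanSpace ℝ (Fin 3)) (a : EuclideanSpace ℝ (Fin 3))
    (R : EuclideanSpace ℝ (Fin 3) ≃ₗᵢ[ℝ] EuclideanSpace ℝ (Fin 3)) (l : ℝ) (x : EuclideanSpace ℝ (Fin 3)) :
    fderiv ℝ (fun x => l • R (m (l • R.symm (x - a)))) x =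
      (l ^ 2 : ℝ) • ((R : EuclideanSpace ℝ (Fin 3) →L[ℝ] EuclideanSpace ℝ (Fin 3)).comp
        ((fderiv ℝ m (l • R.symm (x - a))).comp
          (R.symm : EuclideanSpace ℝ (Fin 3) →L[ℝ] EuclideanSpace ℝ (Fin 3)))) := by
  set v : EuclideanSpace ℝ (Fin 3) → EuclideanSpace ℝ (Fin 3) := fun z => l • m (l • z) with hv
  set g : EuclideanSpace ℝ (Fin 3) → EuclideanSpace ℝ (Fin 3) := fun y => R (v (R.symm y)) with hg
  have hug : (fun x => l • R (m (l • R.symm (x - a)))) = fun x => g (x - a) := by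
    funext x
    simp only [hg, hv, LinearIsometryEquiv.map_smul]
  rw [hug, fderiv_comp_sub, hg, fderiv_conj_linearIsometryEquiv, hv, fderiv_const_smul_comp_smul_apply,
    ContinuousLinearMap.smul_comp, ContinuousLinearMap.comp_smul, sq]

/-- **Vorticity of an orbit slice** (pseudovector law): `curl (x ↦ l•R(m(l•R⁻¹(x − a))))(x) = (l² det R) • R (curl m (l•R⁻¹(x − a)))`. [folklore] -/
theorem curl_orbitSlice (m : EuclideanSpace ℝ (Fin 3) → EuclideanSpace ℝ (Fin 3)) (a : EuclideanSpace ℝ (Fin 3))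
    (R : EuclideanSpace ℝ (Fin 3) ≃ₗᵢ[ℝ] EuclideanSpace ℝ (Fin 3)) (l : ℝ) (x : EuclideanSpace ℝ (Fin 3)) :
    curl (fun x => l • R (m (l • R.symm (x - a)))) x =
      (l ^ 2 * (R : EuclideanSpace ℝ (Fin 3) →L[ℝ] EuclideanSpace ℝ (Fin 3)).det) •
        R (curl m (l • R.symm (x - a))) := by
  set v : EuclideanSpace ℝ (Fin 3) → EuclideanSpace ℝ (Fin 3) := fun z => l • m (l • z) with hv
  set g : EuclideanSpace ℝ (Fin 3) → EuclideanSpace ℝ (Fin 3) := fun y => R (v (R.symm y)) with hg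
  have hug : (fun x => l • R (m (l • R.symm (x - a)))) = fun x => g (x - a) := by
    funext x
    simp only [hg, hv, LinearIsometryEquiv.map_smul]
  rw [hug, curl_comp_sub_const, hg, curl_conj_linearIsometryEquiv, hv, curl_smul_comp_smul,
    LinearIsometryEquiv.map_smul, smul_smul]
  congr 1
  ring

/-- The vorticity of an orbit slice is `(l · det R)` times the orbit slice of the vorticity. [folklore] -/
theorem curl_orbitSlice_eq (m : EuclideanSpace ℝ (Fin 3) → EuclideanSpace ℝ (Fin 3)) (a : EuclideanSpace ℝ (Fin 3))
    (R : EuclideanSpace ℝ (Fin 3) ≃ₗᵢ[ℝ] EuclideanSpace ℝ (Fin 3)) (l : ℝ) :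
    curl (fun x => l • R (m (l • R.symm (x - a)))) =
      (l * (R : EuclideanSpace ℝ (Fin 3) →L[ℝ] EuclideanSpace ℝ (Fin 3)).det) •
        fun x => l • R (curl m (l • R.symm (x - a))) := by
  funext x
  rw [curl_orbitSlice, Pi.smul_apply, smul_smul]
  congr 1
  ring

/-- **Vorticity gradient of an orbit slice**: `D curl (g·m)(x) = (l³ det R) · R ∘ D(curl m)(l•R⁻¹(x − a)) ∘ R⁻¹`. [folklore] -/
theorem fderiv_curl_orbitSlice (m : EuclideanSpace ℝ (Fin 3) → EuclideanSpace ℝ (Fin 3)) (a : EuclideanSpace ℝ (Fin 3))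
    (R : EuclideanSpace ℝ (Fin 3) ≃ₗᵢ[ℝ] EuclideanSpace ℝ (Fin 3)) (l : ℝ) (x : EuclideanSpace ℝ (Fin 3)) :
    fderiv ℝ (curl (fun x => l • R (m (l • R.symm (x - a))))) x =
      (l ^ 3 * (R : EuclideanSpace ℝ (Fin 3) →L[ℝ] EuclideanSpace ℝ (Fin 3)).det) •
        ((R : EuclideanSpace ℝ (Fin 3) →L[ℝ] EuclideanSpace ℝ (Fin 3)).comp
          ((fderiv ℝ (curl m) (l • R.symm (x - a))).comp
            (R.symm : EuclideanSpace ℝ (Fin 3) →L[ℝ] EuclideanSpace ℝ (Fin 3)))) := by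
  rw [curl_orbitSlice_eq, fderiv_const_smul_field, Pi.smul_apply, fderiv_orbitSlice, smul_smul]
  congr 1
  ring

/-! ## Pointwise densities -/

/-- **Palinstrophy density**: `|D curl (g·m)(x)|²_F = l⁶ · |D curl m (l•R⁻¹(x − a))|²_F` (`(det R)² = 1`). [folklore] -/
theorem frobeniusNormSq_fderiv_curl_orbitSlice (m : EuclideanSpace ℝ (Fin 3) → EuclideanSpace ℝ (Fin 3))
    (a : EuclideanSpace ℝ (Fin 3)) (R : EuclideanSpace ℝ (Fin 3) ≃ₗᵢ[ℝ] EuclideanSpace ℝ (Fin 3)) (l : ℝ)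
    (x : EuclideanSpace ℝ (Fin 3)) :
    frobeniusNormSq (fderiv ℝ (curl (fun x => l • R (m (l • R.symm (x - a))))) x) =
      l ^ 6 * frobeniusNormSq (fderiv ℝ (curl m) (l • R.symm (x - a))) := by
  -- `|c • L|²_F = c²|L|²_F` and `|R ∘ L ∘ R⁻¹|²_F = |L|²_F` (both landed elsewhere in the tree; kept as local facts)
  have hsmul : ∀ (c : ℝ) (L : EuclideanSpace ℝ (Fin 3) →L[ℝ] EuclideanSpace ℝ (Fin 3)),
      frobeniusNormSq (c • L) = c ^ 2 * frobeniusNormSq L := fun c L => by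
    unfold frobeniusNormSq
    rw [Finset.mul_sum]
    refine Finset.sum_congr rfl fun i _ => ?_
    rw [FunLike.coe_smul, Pi.smul_apply, norm_smul, mul_pow, Real.norm_eq_abs, sq_abs]
  have hconj : ∀ L : EuclideanSpace ℝ (Fin 3) →L[ℝ] EuclideanSpace ℝ (Fin 3),
      frobeniusNormSq ((R : EuclideanSpace ℝ (Fin 3) →L[ℝ] EuclideanSpace ℝ (Fin 3)).comp
        (L.comp (R.symm : EuclideanSpace ℝ (Fin 3) →L[ℝ] EuclideanSpace ℝ (Fin 3)))) = frobeniusNormSq L := fun L => by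
    rw [frobeniusNormSq, frobeniusNormSq_eq_sum ((stdOrthonormalBasis ℝ (EuclideanSpace ℝ (Fin 3))).map R.symm) L]
    refine Finset.sum_congr rfl fun i _ => ?_
    simp only [ContinuousLinearMap.comp_apply, LinearIsometryEquiv.coe_coe'', LinearIsometryEquiv.norm_map,
      OrthonormalBasis.map_apply]
  rw [fderiv_curl_orbitSlice, hsmul, hconj, mul_pow, ← pow_mul, sq, det_linearIsometryEquiv_mul_self]
  ring

/-- **Stretching density**: `⟪ω', Du' ω'⟫(x) = l⁶ · ⟪ω, Dm ω⟫(l•R⁻¹(x − a))` for the orbit slice `u'` of `m`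
(`ω' = curl u'`, `ω = curl m`). [folklore] -/
theorem stretchingDensity_orbitSlice (m : EuclideanSpace ℝ (Fin 3) → EuclideanSpace ℝ (Fin 3))
    (a : EuclideanSpace ℝ (Fin 3)) (R : EuclideanSpace ℝ (Fin 3) ≃ₗᵢ[ℝ] EuclideanSpace ℝ (Fin 3)) (l : ℝ)
    (x : EuclideanSpace ℝ (Fin 3)) :
    ⟪curl (fun x => l • R (m (l • R.symm (x - a)))) x,
        fderiv ℝ (fun x => l • R (m (l • R.symm (x - a)))) x (curl (fun x => l • R (m (l • R.symm (x - a)))) x)⟫_ℝ =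
      l ^ 6 * ⟪curl m (l • R.symm (x - a)), fderiv ℝ m (l • R.symm (x - a)) (curl m (l • R.symm (x - a)))⟫_ℝ := by
  rw [curl_orbitSlice, fderiv_orbitSlice]
  simp only [FunLike.coe_smul, Pi.smul_apply, ContinuousLinearMap.comp_apply,
    LinearIsometryEquiv.coe_coe'', LinearIsometryEquiv.symm_apply_apply, map_smul, inner_smul_left,
    inner_smul_right, LinearIsometryEquiv.inner_map_map, RCLike.conj_to_real]
  have hd := det_linearIsometryEquiv_mul_self R
  set d := (R : EuclideanSpace ℝ (Fin 3) →L[ℝ] EuclideanSpace ℝ (Fin 3)).det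
  have h6 : l ^ 2 * d * (l ^ 2 * (l ^ 2 * d)) = l ^ 6 := by
    calc l ^ 2 * d * (l ^ 2 * (l ^ 2 * d)) = l ^ 6 * (d * d) := by ring
      _ = l ^ 6 := by rw [hd, mul_one]
  simp only [← mul_assoc] at h6 ⊢
  rw [h6]

/-! ## Integrated laws: `Pal ↦ l³·Pal`, `S ↦ l³·S` (and `Z ↦ l·Z`, landed) -/

/-- Change of variables under the orbit map: `∫ F(l•R⁻¹(x − a)) dx = (l³)⁻¹ ∫ F` (`l > 0`). [folklore] -/
theorem integral_comp_orbitMap (F : EuclideanSpace ℝ (Fin 3) → ℝ) (a : EuclideanSpace ℝ (Fin 3))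
    (R : EuclideanSpace ℝ (Fin 3) ≃ₗᵢ[ℝ] EuclideanSpace ℝ (Fin 3)) {l : ℝ} (hl : 0 < l) :
    ∫ x, F (l • R.symm (x - a)) = (l ^ 3)⁻¹ * ∫ x, F x := by
  rw [integral_sub_right_eq_self (fun y => F (l • R.symm y)) a]
  have hR : ∫ y, F (l • R.symm y) = ∫ z, F (l • z) :=
    R.symm.measurePreserving.integral_comp R.symm.toHomeomorph.measurableEmbedding (fun z => F (l • z))
  rw [hR, Measure.integral_comp_smul volume F l, finrank_euclideanSpace_fin, abs_of_pos (inv_pos.2 (pow_pos hl 3)),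
    smul_eq_mul]

/-- **Palinstrophy of an orbit slice**: `Pal(x ↦ l•R(m(l•R⁻¹(x − a)))) = l³ · Pal(m)` (`l > 0`). [folklore] -/
theorem integral_palinstrophy_orbitSlice (m : EuclideanSpace ℝ (Fin 3) → EuclideanSpace ℝ (Fin 3))
    (a : EuclideanSpace ℝ (Fin 3)) (R : EuclideanSpace ℝ (Fin 3) ≃ₗᵢ[ℝ] EuclideanSpace ℝ (Fin 3)) {l : ℝ} (hl : 0 < l) :
    ∫ x, frobeniusNormSq (fderiv ℝ (curl (fun x => l • R (m (l • R.symm (x - a))))) x) =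
      l ^ 3 * ∫ x, frobeniusNormSq (fderiv ℝ (curl m) x) := by
  simp_rw [frobeniusNormSq_fderiv_curl_orbitSlice m a R l]
  rw [integral_const_mul, integral_comp_orbitMap (fun z => frobeniusNormSq (fderiv ℝ (curl m) z)) a R hl]
  have hl3 : (l ^ 3 : ℝ) ≠ 0 := pow_ne_zero 3 hl.ne'
  field_simp

/-- **Stretching of an orbit slice**: `S(x ↦ l•R(m(l•R⁻¹(x − a)))) = l³ · S(m)` (`l > 0`), `S(v) = ∫⟪curl v, Dv curl v⟫`. [folklore] -/
theorem integral_stretching_orbitSlice (m : EuclideanSpace ℝ (Fin 3) → EuclideanSpace ℝ (Fin 3))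
    (a : EuclideanSpace ℝ (Fin 3)) (R : EuclideanSpace ℝ (Fin 3) ≃ₗᵢ[ℝ] EuclideanSpace ℝ (Fin 3)) {l : ℝ} (hl : 0 < l) :
    ∫ x, ⟪curl (fun x => l • R (m (l • R.symm (x - a)))) x,
        fderiv ℝ (fun x => l • R (m (l • R.symm (x - a)))) x (curl (fun x => l • R (m (l • R.symm (x - a)))) x)⟫_ℝ =
      l ^ 3 * ∫ x, ⟪curl m x, fderiv ℝ m x (curl m x)⟫_ℝ := by
  simp_rw [stretchingDensity_orbitSlice m a R l]
  rw [integral_const_mul,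
    integral_comp_orbitMap (fun z => ⟪curl m z, fderiv ℝ m z (curl m z)⟫_ℝ) a R hl]
  have hl3 : (l ^ 3 : ℝ) ≠ 0 := pow_ne_zero 3 hl.ne'
  field_simp

/-- **The efficiency is an orbit invariant**: with `Z ↦ lZ`, `Pal ↦ l³Pal`, `S ↦ l³S`, the sharp-exponent envelope value
`Z^{3/4} Pal^{3/4}` scales like `S`: `(lZ)^{3/4} (l³Pal)^{3/4} = l³ Z^{3/4} Pal^{3/4}` (`l > 0`, `Z, Pal ≥ 0`). [folklore] -/
theorem envelope_scaling {l Z P : ℝ} (hl : 0 < l) (hZ : 0 ≤ Z) (hP : 0 ≤ P) :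
    (l * Z) ^ (3 / 4 : ℝ) * (l ^ 3 * P) ^ (3 / 4 : ℝ) = l ^ 3 * (Z ^ (3 / 4 : ℝ) * P ^ (3 / 4 : ℝ)) := by
  rw [Real.mul_rpow hl.le hZ, Real.mul_rpow (pow_nonneg hl.le 3) hP, ← Real.rpow_natCast_mul hl.le]
  have h : l ^ (3 / 4 : ℝ) * l ^ ((3 : ℕ) * (3 / 4 : ℝ)) = l ^ 3 := by
    rw [← Real.rpow_add hl, ← Real.rpow_natCast l 3]
    norm_num
  calc l ^ (3 / 4 : ℝ) * Z ^ (3 / 4 : ℝ) * (l ^ ((3 : ℕ) * (3 / 4 : ℝ)) * P ^ (3 / 4 : ℝ))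
        = (l ^ (3 / 4 : ℝ) * l ^ ((3 : ℕ) * (3 / 4 : ℝ))) * (Z ^ (3 / 4 : ℝ) * P ^ (3 / 4 : ℝ)) := by ring
    _ = l ^ 3 * (Z ^ (3 / 4 : ℝ) * P ^ (3 / 4 : ℝ)) := by rw [h]

/-- **The normalised-maximiser identities transfer along symmetry orbits.** If `m` has `Z(m) > 0`,
`S(m) = c·Z(m)^{3/4}·Pal(m)^{3/4}` and `Pal(m) = κ·Z(m)³` (clause (a) of `MaximiserSetRigidity` with `κ = 81c⁴/(256ν⁴)`),
then every orbit point `x ↦ l•R(m(l•R⁻¹(x − a)))` (`l > 0`) satisfies the same three identities. [folklore] -/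
theorem normalisedMaximiser_identities_orbitSlice {c κ : ℝ}
    (m : EuclideanSpace ℝ (Fin 3) → EuclideanSpace ℝ (Fin 3)) (a : EuclideanSpace ℝ (Fin 3))
    (R : EuclideanSpace ℝ (Fin 3) ≃ₗᵢ[ℝ] EuclideanSpace ℝ (Fin 3)) {l : ℝ} (hl : 0 < l)
    (hZ : 0 < ∫ x, ‖curl m x‖ ^ 2)
    (hS : (∫ x, ⟪curl m x, fderiv ℝ m x (curl m x)⟫_ℝ) =
      c * (∫ x, ‖curl m x‖ ^ 2) ^ (3 / 4 : ℝ) * (∫ x, frobeniusNormSq (fderiv ℝ (curl m) x)) ^ (3 / 4 : ℝ))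
    (hN : (∫ x, frobeniusNormSq (fderiv ℝ (curl m) x)) = κ * (∫ x, ‖curl m x‖ ^ 2) ^ 3) :
    (0 < ∫ x, ‖curl (fun x => l • R (m (l • R.symm (x - a)))) x‖ ^ 2) ∧
    (∫ x, ⟪curl (fun x => l • R (m (l • R.symm (x - a)))) x,
        fderiv ℝ (fun x => l • R (m (l • R.symm (x - a)))) x (curl (fun x => l • R (m (l • R.symm (x - a)))) x)⟫_ℝ) =
      c * (∫ x, ‖curl (fun x => l • R (m (l • R.symm (x - a)))) x‖ ^ 2) ^ (3 / 4 : ℝ) *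
        (∫ x, frobeniusNormSq (fderiv ℝ (curl (fun x => l • R (m (l • R.symm (x - a))))) x)) ^ (3 / 4 : ℝ) ∧
    (∫ x, frobeniusNormSq (fderiv ℝ (curl (fun x => l • R (m (l • R.symm (x - a))))) x)) =
      κ * (∫ x, ‖curl (fun x => l • R (m (l • R.symm (x - a)))) x‖ ^ 2) ^ 3 := by
  have hP : 0 ≤ ∫ x, frobeniusNormSq (fderiv ℝ (curl m) x) := integral_nonneg fun x => frobeniusNormSq_nonneg _
  rw [integral_curl_sq_orbitSlice m a R hl, integral_palinstrophy_orbitSlice m a R hl,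
    integral_stretching_orbitSlice m a R hl, hS, hN]
  refine ⟨mul_pos hl hZ, ?_, by ring⟩
  rw [← hN, mul_assoc c, mul_assoc c, envelope_scaling hl hZ.le hP]
  ring

end OrbitInvariance

end MaximiserSetRigidity

end Summit.NavierStokesRegularity.NavierStokesRegularity.Theorems

end
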